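import Mathlib.Data.Matrix.Block
import Mathlib.LinearAlgebra.Matrix.Reindex
import Mathlib.LinearAlgebra.Matrix.GeneralLinearGroup.Defs
import HarnessLib

/-!
# Realisation of a residual class by an integral frame is a property of the PROJECTIVE CLASS

Lead prover-line-stmt-Langlands-13639-c2-0 (line `sector-klingen-split`, crux `ResiduallyYoshidaLifting`,
stmt-Langlands-13639).  In the registered stubs `stub_selmerAnchor` / `stub_nonsplitPropagation` (skeleton rev 2)
"`ρ` REALISES the residual cocycle `B`" is spelled
`ρ̄(g) = h · reindex e e (fromBlocks (σ g) (B g) 0 (σ' g)) · h⁻¹` for some residual conjugator `h ∈ GL₄(k)`.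
This file records, kernel-checked, that the realised classes are stable under the two changes of `B` that do not
change its class in `ℙ H¹(Γ, Hom(σ', σ))`:
* `realises_smul`  — scaling `B ↦ c • B` (`c ∈ kˣ`) is absorbed into `h` (conjugate by `diag(c·1, 1)`), so NO
  lift of `c` through `red : 𝒪 → k` is needed (`red` is not assumed surjective);
* `realises_add_coboundary` — `B ↦ B + (σ X - X σ')` is absorbed into `h` (conjugate by the unipotent `(1, X; 0, 1)`);
* `exists_coboundary_smul_add_iff` — "`B` is a coboundary" is invariant under the same changes.
Hence the hypotheses and conclusions of the anchor / propagation stubs depend on `B` only through the line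
`k^× · [B]`; in particular on a fibre where the realisable classes form a single line, the anchor reduces to the
existence of ONE automorphic irreducible `Sh`-point (answer to the lead's cycle-1 `disprover-wanted` question:
the realisation clause is neither idle nor over-quantified).  Pure matrix algebra over a commutative ring / field;
no definitions (the conjugating units are built inside the proofs).
-/

-- `Summit.Langlands.Langlands.…` (summit = sub-problem name, D-0017 layout) trips `dupNamespace` on every decl.
set_option linter.dupNamespace false
set_option autoImplicit false

namespace Summit.Langlands.Langlands.Cruxes.ResiduallyYoshidaLifting.SectorKlingenSplit.Ribet

section Blocks

variable {R : Type*} [CommRing R] {m : Type*} [Fintype m] [DecidableEq m]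

/-- Scaling the off-diagonal block is conjugation by `diag(c·1, 1)`:
`(c·1, 0; 0, 1) (S, B; 0, S') (c⁻¹·1, 0; 0, 1) = (S, c·B; 0, S')`. [folklore] -/
theorem fromBlocks_smul_conj (c : Rˣ) (S S' B : Matrix m m R) :
    Matrix.fromBlocks ((c : R) • (1 : Matrix m m R)) 0 0 (1 : Matrix m m R) * Matrix.fromBlocks S B 0 S' *
        Matrix.fromBlocks (((c⁻¹ : Rˣ) : R) • (1 : Matrix m m R)) 0 0 (1 : Matrix m m R) =
      Matrix.fromBlocks S ((c : R) • B) 0 S' := by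
  rw [Matrix.fromBlocks_multiply, Matrix.fromBlocks_multiply]
  simp only [Matrix.smul_mul, Matrix.mul_smul, Matrix.one_mul, Matrix.mul_one, Matrix.zero_mul,
    Matrix.mul_zero, add_zero, zero_add, smul_zero, smul_smul, Units.inv_mul, one_smul]

/-- Adding a coboundary to the off-diagonal block is conjugation by a unipotent:
`(1, -X; 0, 1) (S, B; 0, S') (1, X; 0, 1) = (S, B + (S X - X S'); 0, S')`. [folklore] -/
theorem fromBlocks_coboundary_conj (X S S' B : Matrix m m R) :
    Matrix.fromBlocks (1 : Matrix m m R) (-X) 0 (1 : Matrix m m R) * Matrix.fromBlocks S B 0 S' *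
        Matrix.fromBlocks (1 : Matrix m m R) X 0 (1 : Matrix m m R) =
      Matrix.fromBlocks S (B + (S * X - X * S')) 0 S' := by
  rw [Matrix.fromBlocks_multiply, Matrix.fromBlocks_multiply]
  simp only [Matrix.one_mul, Matrix.mul_one, Matrix.zero_mul, Matrix.mul_zero, add_zero, zero_add,
    Matrix.neg_mul]
  congr 1
  abel

/-- The scaling matrices `diag(c·1, 1)` and `diag(c⁻¹·1, 1)` are mutually inverse. [folklore] -/
theorem fromBlocks_smul_mul_fromBlocks_smul_inv (c : Rˣ) :
    Matrix.fromBlocks ((c : R) • (1 : Matrix m m R)) 0 0 (1 : Matrix m m R) *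
        Matrix.fromBlocks (((c⁻¹ : Rˣ) : R) • (1 : Matrix m m R)) 0 0 (1 : Matrix m m R) = 1 := by
  rw [Matrix.fromBlocks_multiply]
  simp only [Matrix.smul_mul, Matrix.mul_smul, Matrix.one_mul, Matrix.zero_mul, Matrix.mul_zero, add_zero,
    zero_add, smul_zero, smul_smul, Units.inv_mul, one_smul, Matrix.fromBlocks_one]

/-- The unipotents `(1, X; 0, 1)` and `(1, -X; 0, 1)` are mutually inverse. [folklore] -/
theorem fromBlocks_unipotent_mul_neg (X : Matrix m m R) :
    Matrix.fromBlocks (1 : Matrix m m R) X 0 (1 : Matrix m m R) *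
        Matrix.fromBlocks (1 : Matrix m m R) (-X) 0 (1 : Matrix m m R) = 1 := by
  rw [Matrix.fromBlocks_multiply]
  simp only [Matrix.one_mul, Matrix.mul_one, Matrix.zero_mul, Matrix.mul_zero, add_zero, zero_add,
    neg_add_cancel, Matrix.fromBlocks_one]

end Blocks

/-- `reindex e e` is multiplicative. [folklore] -/
theorem reindex_mul_reindex {R : Type*} [CommRing R] {m ι : Type*} [Fintype m] [Fintype ι] (e : m ⊕ m ≃ ι)
    (A B : Matrix (m ⊕ m) (m ⊕ m) R) :
    Matrix.reindex e e (A * B) = Matrix.reindex e e A * Matrix.reindex e e B :=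
  (Matrix.reindexRingEquiv R e).map_mul A B

/-- `reindex e e 1 = 1`. [folklore] -/
theorem reindex_one_eq_one {R : Type*} [CommRing R] {m ι : Type*} [DecidableEq m] [DecidableEq ι]
    (e : m ⊕ m ≃ ι) : Matrix.reindex e e (1 : Matrix (m ⊕ m) (m ⊕ m) R) = 1 := by
  rw [Matrix.reindex_apply, Matrix.submatrix_one_equiv]

section Realisation

variable {k : Type*} [Field k] {m ι : Type*} [Fintype m] [DecidableEq m] [Fintype ι] [DecidableEq ι]
  {Γ : Type*}

/-- A conjugation identity `A * M * A' = M'` with `A * A' = 1 = A' * A` transports a realisation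
`ρ̄ = h M h⁻¹` to `ρ̄ = h'' M' h''⁻¹` with `h'' = h · A'` (as a unit). [folklore] -/
theorem realises_of_conj_identity (ρk : Γ → Matrix ι ι k) (M M' : Γ → Matrix ι ι k) (h : GL ι k)
    (A A' : Matrix ι ι k) (hAA' : A * A' = 1) (hA'A : A' * A = 1) (hM : ∀ g, A * M g * A' = M' g)
    (hB : ∀ g, ρk g = (h : Matrix ι ι k) * M g * ((h⁻¹ : GL ι k) : Matrix ι ι k)) :
    ∃ h' : GL ι k, ∀ g, ρk g = (h' : Matrix ι ι k) * M' g * ((h'⁻¹ : GL ι k) : Matrix ι ι k) := by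
  refine ⟨h * ⟨A', A, hA'A, hAA'⟩, fun g => ?_⟩
  rw [hB g, ← hM g, mul_inv_rev, Units.val_mul, Units.val_mul]
  change _ = (h : Matrix ι ι k) * A' * (A * M g * A') * (A * ((h⁻¹ : GL ι k) : Matrix ι ι k))
  simp only [← Matrix.mul_assoc]
  rw [Matrix.mul_assoc (h : Matrix ι ι k) A' A, hA'A, Matrix.mul_one, Matrix.mul_assoc _ A' A, hA'A,
    Matrix.mul_one]

/-- **Realisation is invariant under scaling the class.**  If `ρ̄ = h (σ, B; 0, σ') h⁻¹` then
`ρ̄ = h' (σ, c·B; 0, σ') h'⁻¹` for some `h'` (namely `h · diag(c·1, 1)⁻¹`); no lift of `c` to the coefficient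
ring of `ρ` is used. [folklore] -/
theorem realises_smul (e : m ⊕ m ≃ ι) (ρk : Γ → Matrix ι ι k) (S S' B : Γ → Matrix m m k) (h : GL ι k)
    (c : kˣ)
    (hB : ∀ g, ρk g = (h : Matrix ι ι k) * Matrix.reindex e e (Matrix.fromBlocks (S g) (B g) 0 (S' g)) *
      ((h⁻¹ : GL ι k) : Matrix ι ι k)) :
    ∃ h' : GL ι k, ∀ g, ρk g = (h' : Matrix ι ι k) *
      Matrix.reindex e e (Matrix.fromBlocks (S g) ((c : k) • B g) 0 (S' g)) * ((h'⁻¹ : GL ι k) : Matrix ι ι k) := by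
  have hinv := fromBlocks_smul_mul_fromBlocks_smul_inv (m := m) (c⁻¹ : kˣ)
  rw [inv_inv] at hinv
  refine realises_of_conj_identity ρk _ _ h
    (Matrix.reindex e e (Matrix.fromBlocks ((c : k) • (1 : Matrix m m k)) 0 0 (1 : Matrix m m k)))
    (Matrix.reindex e e (Matrix.fromBlocks (((c⁻¹ : kˣ) : k) • (1 : Matrix m m k)) 0 0 (1 : Matrix m m k)))
    ?_ ?_ (fun g => ?_) hB
  · rw [← reindex_mul_reindex, fromBlocks_smul_mul_fromBlocks_smul_inv, reindex_one_eq_one]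
  · rw [← reindex_mul_reindex, hinv, reindex_one_eq_one]
  · rw [← reindex_mul_reindex, ← reindex_mul_reindex, fromBlocks_smul_conj]

/-- **Realisation is invariant under adding a coboundary to the class.**  If `ρ̄ = h (σ, B; 0, σ') h⁻¹` then
`ρ̄ = h' (σ, B + (σ X - X σ'); 0, σ') h'⁻¹` for some `h'` (namely `h · (1, X; 0, 1)`). [folklore] -/
theorem realises_add_coboundary (e : m ⊕ m ≃ ι) (ρk : Γ → Matrix ι ι k) (S S' B : Γ → Matrix m m k)
    (h : GL ι k) (X : Matrix m m k)
    (hB : ∀ g, ρk g = (h : Matrix ι ι k) * Matrix.reindex e e (Matrix.fromBlocks (S g) (B g) 0 (S' g)) *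
      ((h⁻¹ : GL ι k) : Matrix ι ι k)) :
    ∃ h' : GL ι k, ∀ g, ρk g = (h' : Matrix ι ι k) *
      Matrix.reindex e e (Matrix.fromBlocks (S g) (B g + (S g * X - X * S' g)) 0 (S' g)) *
        ((h'⁻¹ : GL ι k) : Matrix ι ι k) := by
  have hinv := fromBlocks_unipotent_mul_neg (m := m) (-X)
  rw [neg_neg] at hinv
  refine realises_of_conj_identity ρk _ _ h
    (Matrix.reindex e e (Matrix.fromBlocks (1 : Matrix m m k) (-X) 0 (1 : Matrix m m k)))
    (Matrix.reindex e e (Matrix.fromBlocks (1 : Matrix m m k) X 0 (1 : Matrix m m k)))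
    ?_ ?_ (fun g => ?_) hB
  · rw [← reindex_mul_reindex, hinv, reindex_one_eq_one]
  · rw [← reindex_mul_reindex, fromBlocks_unipotent_mul_neg, reindex_one_eq_one]
  · rw [← reindex_mul_reindex, ← reindex_mul_reindex, fromBlocks_coboundary_conj]

omit [DecidableEq m] in
/-- **Being a coboundary is a property of the projective class**: `c • B + (σ X - X σ')` is a coboundary iff
`B` is (`c ∈ kˣ`). [folklore] -/
theorem exists_coboundary_smul_add_iff (S S' B : Γ → Matrix m m k) (c : kˣ) (X : Matrix m m k) :
    (∃ Y : Matrix m m k, ∀ g, (c : k) • B g + (S g * X - X * S' g) = S g * Y - Y * S' g) ↔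
      ∃ Y : Matrix m m k, ∀ g, B g = S g * Y - Y * S' g := by
  constructor
  · rintro ⟨Y, hY⟩
    refine ⟨((c⁻¹ : kˣ) : k) • (Y - X), fun g => ?_⟩
    have h1 : (c : k) • B g = S g * (Y - X) - (Y - X) * S' g := by
      rw [eq_sub_of_add_eq (hY g), Matrix.mul_sub, Matrix.sub_mul]
      abel
    rw [Matrix.mul_smul, Matrix.smul_mul, ← smul_sub, ← h1, smul_smul, Units.inv_mul, one_smul]
  · rintro ⟨Y, hY⟩
    refine ⟨(c : k) • Y + X, fun g => ?_⟩
    rw [hY g, Matrix.mul_add, Matrix.add_mul, Matrix.mul_smul, Matrix.smul_mul, smul_sub]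
    abel

omit [DecidableEq m] in
/-- Contrapositive packaging used by the stubs: `B` is not a coboundary iff `c • B + (σ X - X σ')` is not.
[folklore] -/
theorem not_exists_coboundary_smul_add_iff (S S' B : Γ → Matrix m m k) (c : kˣ) (X : Matrix m m k) :
    (¬ ∃ Y : Matrix m m k, ∀ g, (c : k) • B g + (S g * X - X * S' g) = S g * Y - Y * S' g) ↔
      ¬ ∃ Y : Matrix m m k, ∀ g, B g = S g * Y - Y * S' g :=
  (exists_coboundary_smul_add_iff S S' B c X).not

/-- **Realisation depends only on the projective class** (both moves at once): if `ρ̄ = h (σ, B; 0, σ') h⁻¹`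
then for every `c ∈ kˣ` and `X`, `ρ̄ = h' (σ, c·B + (σ X - X σ'); 0, σ') h'⁻¹` for some `h'`. [folklore] -/
theorem realises_smul_add_coboundary (e : m ⊕ m ≃ ι) (ρk : Γ → Matrix ι ι k) (S S' B : Γ → Matrix m m k)
    (h : GL ι k) (c : kˣ) (X : Matrix m m k)
    (hB : ∀ g, ρk g = (h : Matrix ι ι k) * Matrix.reindex e e (Matrix.fromBlocks (S g) (B g) 0 (S' g)) *
      ((h⁻¹ : GL ι k) : Matrix ι ι k)) :
    ∃ h' : GL ι k, ∀ g, ρk g = (h' : Matrix ι ι k) *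
      Matrix.reindex e e (Matrix.fromBlocks (S g) ((c : k) • B g + (S g * X - X * S' g)) 0 (S' g)) *
        ((h'⁻¹ : GL ι k) : Matrix ι ι k) := by
  obtain ⟨h₁, h₁B⟩ := realises_smul e ρk S S' B h c hB
  exact realises_add_coboundary e ρk S S' (fun g => (c : k) • B g) h₁ X h₁B

end Realisation

/-- **Registered statement `stub_realisesProjectiveClass`** (crux stmt-Langlands-13639, line `sector-klingen-split`,
skeleton rev 2): realisation of `B` by `ρ̄` up to a residual conjugator, and "`B` is not a coboundary", are both
unchanged under `B ↦ c • B + (σ X - X σ')` (`c ∈ kˣ`) — the realised class is a point of `ℙ H¹`. [folklore] -/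
theorem stub_realisesProjectiveClass :
    ∀ (k : Type) [Field k] (m ι Γ : Type) [Fintype m] [DecidableEq m] [Fintype ι] [DecidableEq ι]
      (e : m ⊕ m ≃ ι) (ρk : Γ → Matrix ι ι k) (S S' B : Γ → Matrix m m k) (h : GL ι k) (c : kˣ)
      (X : Matrix m m k),
      (∀ g, ρk g = (h : Matrix ι ι k) * Matrix.reindex e e (Matrix.fromBlocks (S g) (B g) 0 (S' g)) *
        ((h⁻¹ : GL ι k) : Matrix ι ι k)) →
      (∃ h' : GL ι k, ∀ g, ρk g = (h' : Matrix ι ι k) *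
        Matrix.reindex e e (Matrix.fromBlocks (S g) ((c : k) • B g + (S g * X - X * S' g)) 0 (S' g)) *
          ((h'⁻¹ : GL ι k) : Matrix ι ι k)) ∧
      ((¬ ∃ Y : Matrix m m k, ∀ g, (c : k) • B g + (S g * X - X * S' g) = S g * Y - Y * S' g) ↔
        ¬ ∃ Y : Matrix m m k, ∀ g, B g = S g * Y - Y * S' g) := by
  intro k _ m ι Γ _ _ _ _ e ρk S S' B h c X hB
  exact ⟨realises_smul_add_coboundary e ρk S S' B h c X hB, not_exists_coboundary_smul_add_iff S S' B c X⟩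

end Summit.Langlands.Langlands.Cruxes.ResiduallyYoshidaLifting.SectorKlingenSplit.Ribet
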